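import Summits.Ventures.CertifiedManyBodySolver.Upper.BlochDressedBound
import Summits.Ventures.CertifiedManyBodySolver.Upper.BlochDressedPeriodic
import HarnessLib

/-!
# Ventures/CertifiedManyBodySolver — Upper/BlochDressedCellBound.lean

HONEST FRAMING: first certified bounds; not a superconductivity verdict; every number certified or labelled float.

THE PLAQUETTE-DRESSED BLOCH BOUND IN CELL FORM (sr-mbsolver L3 engine seat E1; steps D1–D3 of the Lean route for the plaquette-dressed
translation-invariant quasi-free uppers, eng-1/LEAN-GLUE-QF.md §4, combined; theorem-only, no certificate value appears, nothing is
claimed). Torus `(ℤ/2m)²`, even magnetic cell `M i = 2 q i` (`k i · M i = 2m`), blocks `Q σ κ` with spectra in `[0,1]`, mean filling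
`n̄ ∈ (0,2)`, `U ≥ 0`, and a CELL-PERIODIC layer of number-conserving plaquette unitaries `u_c = v_{c mod q}`:

  `e(t,U;n̄) ≤ re 𝒞_v(Q) / |cell| + K'_v / (2m)² + 16|t| / (2m)`,

where `𝒞_v(Q) = Σ_r [⟨v_rᴴ H_plaq v_r⟩_{ρ(W₈(Q;r))} + Σ_j ⟨V_{r,j}ᴴ T_j V_{r,j}⟩_{ρ(W₁₆(Q;r,j))}]` is the offset sum of
`Upper/BlochDressedPeriodic.lean` (the window blocks are harmonics `|k|⁻¹ Σ_κ χ_κ(·) Q σ κ` of the reference), `|cell| = Π_i M i`, and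
`K'_v = (Σ_r ‖v_rᴴ H_plaq v_r‖₁)·2⁸·8!·128 + (Σ_{r,j} ‖V_{r,j}ᴴ T_j V_{r,j}‖₁)·2¹⁶·16!·512` does NOT depend on the number of cells: along
tori with more and more cells (`|k| → ∞`, `2m → ∞`) and fixed harmonics both error terms vanish. Proof: `energyDensity2D_le_dressed_bloch`
(`Upper/BlochDressedBound.lean`) + the periodic reductions `sum_plaquetteTerm_eq_card_mul_sum_offset`, `sum_linkTerm_eq_card_mul_sum_offset`
and `|k| · |cell| = (2m)²`. Sources: Lieb 1981 [Lieb1981]; Bach–Lieb–Solovej 1994 (2c.36), (3a.2), Thm 2.3 [BachLiebSolovej1994].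
Everything proved; no definition.
-/

noncomputable section

namespace Summit.Ventures.CertifiedManyBodySolver.Upper

open Matrix Finset
open Literature.MathematicalPhysics.QuantumLattice Literature.MathematicalPhysics.QuantumLattice.HartreeFock
  Literature.MathematicalPhysics.QuantumLattice.ThermodynamicLimit HeisenbergTL HubbardWave0 PlaquetteLUC
open scoped ComplexOrder ComplexConjugate

variable {m : ℕ} [NeZero m] {k M : Fin 2 → ℕ} [∀ i, NeZero (k i)] [∀ i, NeZero (M i)] {q : Fin 2 → ℕ}

omit [NeZero m] [∀ i, NeZero (M i)] in
/-- `|k| · |cell| = (2m)²` for a magnetic cell of the torus `(ℤ/2m)²`. [folklore] -/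
theorem card_cells_mul_prod_side (hkM : ∀ i, k i * M i = m * 2) :
    (Fintype.card (RectTorusSite k) : ℝ) * ∏ i, (M i : ℝ) = ((m * 2 : ℕ) : ℝ) ^ 2 := by
  rw [card_rectTorusSite_eq_prod, Nat.cast_prod, ← Finset.prod_mul_distrib]
  rw [show ∏ i : Fin 2, ((k i : ℕ) : ℝ) * (M i : ℝ) = ∏ _i : Fin 2, ((m * 2 : ℕ) : ℝ) from
    Finset.prod_congr rfl fun i _ => by exact_mod_cast hkM i]
  rw [Finset.prod_const, Finset.card_univ, Fintype.card_fin]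

omit [∀ i, NeZero (M i)] in
/-- The `ℓ¹`-masses of the dressed plaquette operators of a cell-periodic dressing sum to `|k| ·` their offset sum. [folklore] -/
theorem sum_plaquetteNorm_eq_card_mul_sum_offset (hkM : ∀ i, k i * M i = m * 2) (hq : ∀ i, M i = 2 * q i) (hq0 : ∀ i, 0 < q i)
    (h : Matrix (Finset (Orb (FermionTorus 2 2))) (Finset (Orb (FermionTorus 2 2))) ℂ)
    (u : (Fin 2 → Fin m) → Matrix (Finset (Orb (FermionTorus 2 2))) (Finset (Orb (FermionTorus 2 2))) ℂ)
    (v : ((i : Fin 2) → Fin (q i)) → Matrix (Finset (Orb (FermionTorus 2 2))) (Finset (Orb (FermionTorus 2 2))) ℂ)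
    (huv : ∀ c, u c = v (fun i => ⟨(c i : ℕ) % q i, Nat.mod_lt _ (hq0 i)⟩)) :
    ∑ c : Fin 2 → Fin m, ∑ s : Finset (Orb (FermionTorus 2 2)), ∑ s' : Finset (Orb (FermionTorus 2 2)), ‖((u c)ᴴ * h * u c) s s'‖ =
      (Fintype.card (RectTorusSite k) : ℝ) *
        ∑ r : (i : Fin 2) → Fin (q i), ∑ s : Finset (Orb (FermionTorus 2 2)), ∑ s' : Finset (Orb (FermionTorus 2 2)), ‖((v r)ᴴ * h * v r) s s'‖ := by
  classical
  obtain ⟨Φ, hΦ⟩ : ∃ Φ : (Fin 2 → ℕ) → ℝ, Φ = fun rN => ∑ s : Finset (Orb (FermionTorus 2 2)), ∑ s' : Finset (Orb (FermionTorus 2 2)),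
      ‖((v (fun i => ⟨rN i % q i, Nat.mod_lt _ (hq0 i)⟩))ᴴ * h * v (fun i => ⟨rN i % q i, Nat.mod_lt _ (hq0 i)⟩)) s s'‖ := ⟨_, rfl⟩
  have hF : ∀ c : Fin 2 → Fin m, (∑ s : Finset (Orb (FermionTorus 2 2)), ∑ s' : Finset (Orb (FermionTorus 2 2)),
      ‖((u c)ᴴ * h * u c) s s'‖) = Φ (fun i => (c i : ℕ) % q i) := by
    intro c
    have harg : (fun i => (⟨(c i : ℕ) % q i, Nat.mod_lt _ (hq0 i)⟩ : Fin (q i))) =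
        fun i => ⟨((c i : ℕ) % q i) % q i, Nat.mod_lt _ (hq0 i)⟩ := funext fun i => Fin.ext (Nat.mod_mod _ _).symm
    rw [hΦ, huv c, harg]
  rw [Finset.sum_congr rfl fun c _ => hF c, sum_plaquette_eq_card_mul_sum_offset (k := k) (fun i => k_mul_q_eq hkM hq i) Φ,
    nsmul_eq_mul]
  congr 1
  refine Finset.sum_congr rfl fun r _ => ?_
  have harg : (fun i => (⟨(r i : ℕ) % q i, Nat.mod_lt _ (hq0 i)⟩ : Fin (q i))) = r :=
    funext fun i => Fin.ext (Nat.mod_eq_of_lt (Fin.isLt _))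
  rw [hΦ]
  simp only [harg]

omit [∀ i, NeZero (M i)] in
/-- The `ℓ¹`-masses of the dressed link operators of a cell-periodic dressing sum to `|k| ·` their offset sum. [folklore] -/
theorem sum_linkNorm_eq_card_mul_sum_offset (hkM : ∀ i, k i * M i = m * 2) (hq : ∀ i, M i = 2 * q i) (hm : 2 ≤ m) (hq0 : ∀ i, 0 < q i)
    (T : Fin 2 → Matrix (Finset (Orb (Fin 2 ×ₗ FermionTorus 2 2))) (Finset (Orb (Fin 2 ×ₗ FermionTorus 2 2))) ℂ)
    (u : (Fin 2 → Fin m) → Matrix (Finset (Orb (FermionTorus 2 2))) (Finset (Orb (FermionTorus 2 2))) ℂ)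
    (v : ((i : Fin 2) → Fin (q i)) → Matrix (Finset (Orb (FermionTorus 2 2))) (Finset (Orb (FermionTorus 2 2))) ℂ)
    (huv : ∀ c, u c = v (fun i => ⟨(c i : ℕ) % q i, Nat.mod_lt _ (hq0 i)⟩)) :
    ∑ ℓ : (Fin 2 → Fin m) × Fin 2, ∑ s : Finset (Orb (Fin 2 ×ₗ FermionTorus 2 2)), ∑ s' : Finset (Orb (Fin 2 ×ₗ FermionTorus 2 2)),
        ‖((fermionEmbed inlCell (u ℓ.1) * fermionEmbed inrCell (u (shiftCell ℓ.1 ℓ.2)))ᴴ * T ℓ.2 *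
            (fermionEmbed inlCell (u ℓ.1) * fermionEmbed inrCell (u (shiftCell ℓ.1 ℓ.2)))) s s'‖ =
      (Fintype.card (RectTorusSite k) : ℝ) * ∑ r : (i : Fin 2) → Fin (q i), ∑ j : Fin 2,
        ∑ s : Finset (Orb (Fin 2 ×ₗ FermionTorus 2 2)), ∑ s' : Finset (Orb (Fin 2 ×ₗ FermionTorus 2 2)),
          ‖((fermionEmbed inlCell (v r) * fermionEmbed inrCell
                (v (fun i => ⟨(if i = j then (r i : ℕ) + 1 else (r i : ℕ)) % q i, Nat.mod_lt _ (hq0 i)⟩)))ᴴ * T j *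
              (fermionEmbed inlCell (v r) * fermionEmbed inrCell
                (v (fun i => ⟨(if i = j then (r i : ℕ) + 1 else (r i : ℕ)) % q i, Nat.mod_lt _ (hq0 i)⟩)))) s s'‖ := by
  classical
  obtain ⟨Ψ, hΨ⟩ : ∃ Ψ : (Fin 2 → ℕ) → ℝ, Ψ = fun rN => ∑ j : Fin 2,
      ∑ s : Finset (Orb (Fin 2 ×ₗ FermionTorus 2 2)), ∑ s' : Finset (Orb (Fin 2 ×ₗ FermionTorus 2 2)),
        ‖((fermionEmbed inlCell (v (fun i => ⟨rN i % q i, Nat.mod_lt _ (hq0 i)⟩)) * fermionEmbed inrCell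
              (v (fun i => ⟨(if i = j then rN i + 1 else rN i) % q i, Nat.mod_lt _ (hq0 i)⟩)))ᴴ * T j *
            (fermionEmbed inlCell (v (fun i => ⟨rN i % q i, Nat.mod_lt _ (hq0 i)⟩)) * fermionEmbed inrCell
              (v (fun i => ⟨(if i = j then rN i + 1 else rN i) % q i, Nat.mod_lt _ (hq0 i)⟩)))) s s'‖ := ⟨_, rfl⟩
  have hF : ∀ c : Fin 2 → Fin m, (∑ j : Fin 2, ∑ s : Finset (Orb (Fin 2 ×ₗ FermionTorus 2 2)),
      ∑ s' : Finset (Orb (Fin 2 ×ₗ FermionTorus 2 2)),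
        ‖((fermionEmbed inlCell (u c) * fermionEmbed inrCell (u (shiftCell c j)))ᴴ * T j *
            (fermionEmbed inlCell (u c) * fermionEmbed inrCell (u (shiftCell c j)))) s s'‖) = Ψ (fun i => (c i : ℕ) % q i) := by
    intro c
    rw [hΨ]
    refine Finset.sum_congr rfl fun j _ => ?_
    have harg : (fun i => (⟨(c i : ℕ) % q i, Nat.mod_lt _ (hq0 i)⟩ : Fin (q i))) =
        fun i => ⟨((c i : ℕ) % q i) % q i, Nat.mod_lt _ (hq0 i)⟩ := funext fun i => Fin.ext (Nat.mod_mod _ _).symm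
    have hargS : (fun i => (⟨(shiftCell c j i : ℕ) % q i, Nat.mod_lt _ (hq0 i)⟩ : Fin (q i))) =
        fun i => ⟨(if i = j then (c i : ℕ) % q i + 1 else (c i : ℕ) % q i) % q i, Nat.mod_lt _ (hq0 i)⟩ := by
      funext i
      apply Fin.ext
      show (shiftCell c j i : ℕ) % q i = (if i = j then (c i : ℕ) % q i + 1 else (c i : ℕ) % q i) % q i
      rw [mod_shiftCell hkM hq hm]
      by_cases hij : i = j
      · subst hij; rw [if_pos rfl, if_pos rfl, Nat.mod_add_mod]
      · rw [if_neg hij, if_neg hij, Nat.mod_mod]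
    rw [huv c, huv (shiftCell c j), harg, hargS]
  rw [Fintype.sum_prod_type, Finset.sum_congr rfl fun c _ => hF c,
    sum_plaquette_eq_card_mul_sum_offset (k := k) (fun i => k_mul_q_eq hkM hq i) Ψ, nsmul_eq_mul]
  congr 1
  refine Finset.sum_congr rfl fun r _ => ?_
  have harg : (fun i => (⟨(r i : ℕ) % q i, Nat.mod_lt _ (hq0 i)⟩ : Fin (q i))) = r :=
    funext fun i => Fin.ext (Nat.mod_eq_of_lt (Fin.isLt _))
  rw [hΨ]
  simp only [harg]

/-- **The plaquette-dressed Bloch bound in cell form.** Torus `(ℤ/2m)²` (`m ≥ 2`), even magnetic cell `M i = 2 q i`, `k i · M i = 2m`,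
blocks `Q σ κ` with spectra in `[0,1]`, `n̄ ∈ (0,2)`, `U ≥ 0`, a cell-periodic layer `u_c = v_{c mod q}` of number-conserving plaquette
unitaries: `e(t,U;n̄) ≤ re 𝒞_v(Q)/|cell| + K'_v/(2m)² + 16|t|/(2m)` with the offset sum `𝒞_v(Q)` (plaquette windows `W₈(Q;r)` of zeroth
harmonics, link windows `W₁₆(Q;r,j)` of the harmonics `0, ±e_j`) and the `|k|`-independent constant `K'_v`. [cite: BachLiebSolovej1994, eq. (2c.36)] -/
theorem energyDensity2D_le_dressedCell (hm : 2 ≤ m) (hkM : ∀ i, k i * M i = m * 2) (hq : ∀ i, M i = 2 * q i) (hq0 : ∀ i, 0 < q i)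
    (t : ℝ) {U : ℝ} (hU : 0 ≤ U)
    (Q : Fin 2 → RectTorusSite k → Matrix (RectTorusSite M) (RectTorusSite M) ℂ) (hQh : ∀ σ κ, (Q σ κ).IsHermitian)
    (h0 : ∀ σ κ i, 0 ≤ (hQh σ κ).eigenvalues i) (h1 : ∀ σ κ i, (hQh σ κ).eigenvalues i ≤ 1)
    (hn0 : 0 < (∑ σ, ∑ κ, (Q σ κ).trace).re / ((m * 2 : ℕ) : ℝ) ^ 2)
    (hn2 : (∑ σ, ∑ κ, (Q σ κ).trace).re / ((m * 2 : ℕ) : ℝ) ^ 2 < 2)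
    (v : ((i : Fin 2) → Fin (q i)) → Matrix (Finset (Orb (FermionTorus 2 2))) (Finset (Orb (FermionTorus 2 2))) ℂ)
    (hv : ∀ r, (v r)ᴴ * v r = 1) (hvN : ∀ r, Commute totalNumberOp (v r)) :
    energyDensity2D t U ((∑ σ, ∑ κ, (Q σ κ).trace).re / ((m * 2 : ℕ) : ℝ) ^ 2) ≤
      ((∑ r : (i : Fin 2) → Fin (q i),
          ((∑ s : Finset (Orb (FermionTorus 2 2)), ∑ s' : Finset (Orb (FermionTorus 2 2)),
              ((v r)ᴴ * hamiltonian plaquetteGraph t U * v r) s s' *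
                slaterRDM (Matrix.of fun o o' : Orb (FermionTorus 2 2) => if (ofLex o).2 = (ofLex o').2 then
                  ((Fintype.card (RectTorusSite k) : ℂ))⁻¹ * ∑ κ, Q (ofLex o).2 κ
                    (fun i => (((ofLex (ofLex o).1 i : ℕ) + 2 * (r i : ℕ) : ℕ) : ZMod (M i)))
                    (fun i => (((ofLex (ofLex o').1 i : ℕ) + 2 * (r i : ℕ) : ℕ) : ZMod (M i))) else 0) s s') +
            ∑ j : Fin 2, ∑ s : Finset (Orb (Fin 2 ×ₗ FermionTorus 2 2)), ∑ s' : Finset (Orb (Fin 2 ×ₗ FermionTorus 2 2)),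
              ((fermionEmbed inlCell (v r) * fermionEmbed inrCell
                    (v (fun i => ⟨(if i = j then (r i : ℕ) + 1 else (r i : ℕ)) % q i, Nat.mod_lt _ (hq0 i)⟩)))ᴴ *
                  hamiltonian (linkGraph j) t 0 *
                  (fermionEmbed inlCell (v r) * fermionEmbed inrCell
                    (v (fun i => ⟨(if i = j then (r i : ℕ) + 1 else (r i : ℕ)) % q i, Nat.mod_lt _ (hq0 i)⟩)))) s s' *
                slaterRDM (Matrix.of fun o o' : Orb (Fin 2 ×ₗ FermionTorus 2 2) => if (ofLex o).2 = (ofLex o').2 then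
                  ((Fintype.card (RectTorusSite k) : ℂ))⁻¹ * ∑ κ, blockChar κ
                    ((if (ofLex (ofLex o).1).1 = 0 then (0 : RectTorusSite k) else if (r j : ℕ) + 1 < q j then 0 else Pi.single j 1) -
                      (if (ofLex (ofLex o').1).1 = 0 then (0 : RectTorusSite k) else if (r j : ℕ) + 1 < q j then 0 else Pi.single j 1)) *
                    Q (ofLex o).2 κ
                      (fun i => (((ofLex (ofLex (ofLex o).1).2 i : ℕ) + 2 * (if (ofLex (ofLex o).1).1 = 0 then (r i : ℕ) else
                        if i = j then ((r j : ℕ) + 1) % q j else (r i : ℕ)) : ℕ) : ZMod (M i)))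
                      (fun i => (((ofLex (ofLex (ofLex o').1).2 i : ℕ) + 2 * (if (ofLex (ofLex o').1).1 = 0 then (r i : ℕ) else
                        if i = j then ((r j : ℕ) + 1) % q j else (r i : ℕ)) : ℕ) : ZMod (M i))) else 0) s s'))).re /
          ∏ i, (M i : ℝ) +
        ((∑ r : (i : Fin 2) → Fin (q i), ∑ s : Finset (Orb (FermionTorus 2 2)), ∑ s' : Finset (Orb (FermionTorus 2 2)),
              ‖((v r)ᴴ * hamiltonian plaquetteGraph t U * v r) s s'‖) *
            (2 ^ Fintype.card (Orb (FermionTorus 2 2)) * ((Fintype.card (Orb (FermionTorus 2 2))).factorial *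
              (2 * (Fintype.card (Orb (FermionTorus 2 2)) : ℝ) ^ 2))) +
          (∑ r : (i : Fin 2) → Fin (q i), ∑ j : Fin 2,
              ∑ s : Finset (Orb (Fin 2 ×ₗ FermionTorus 2 2)), ∑ s' : Finset (Orb (Fin 2 ×ₗ FermionTorus 2 2)),
                ‖((fermionEmbed inlCell (v r) * fermionEmbed inrCell
                      (v (fun i => ⟨(if i = j then (r i : ℕ) + 1 else (r i : ℕ)) % q i, Nat.mod_lt _ (hq0 i)⟩)))ᴴ *
                    hamiltonian (linkGraph j) t 0 *
                    (fermionEmbed inlCell (v r) * fermionEmbed inrCell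
                      (v (fun i => ⟨(if i = j then (r i : ℕ) + 1 else (r i : ℕ)) % q i, Nat.mod_lt _ (hq0 i)⟩)))) s s'‖) *
            (2 ^ Fintype.card (Orb (Fin 2 ×ₗ FermionTorus 2 2)) * ((Fintype.card (Orb (Fin 2 ×ₗ FermionTorus 2 2))).factorial *
              (2 * (Fintype.card (Orb (Fin 2 ×ₗ FermionTorus 2 2)) : ℝ) ^ 2)))) / ((m * 2 : ℕ) : ℝ) ^ 2 +
        16 * |t| / ((m * 2 : ℕ) : ℝ) := by
  classical
  -- the periodic dressing on the torus
  obtain ⟨u, hu⟩ : ∃ u : (Fin 2 → Fin m) → Matrix (Finset (Orb (FermionTorus 2 2))) (Finset (Orb (FermionTorus 2 2))) ℂ,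
      u = fun c => v (fun i => ⟨(c i : ℕ) % q i, Nat.mod_lt _ (hq0 i)⟩) := ⟨_, rfl⟩
  have huv : ∀ c, u c = v (fun i => ⟨(c i : ℕ) % q i, Nat.mod_lt _ (hq0 i)⟩) := fun c => by rw [hu]
  have huu : ∀ c, (u c)ᴴ * u c = 1 := fun c => by rw [huv]; exact hv _
  have huN : ∀ c, Commute totalNumberOp (u c) := fun c => by rw [huv]; exact hvN _
  have hD := energyDensity2D_le_dressed_bloch hm hkM t hU Q hQh h0 h1 hn0 hn2 u huu huN
  -- periodic reductions
  rw [sum_plaquetteTerm_eq_card_mul_sum_offset hkM hq hq0 Q (hamiltonian plaquetteGraph t U) u v huv,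
    sum_linkTerm_eq_card_mul_sum_offset hkM hq hm hq0 Q (fun j => hamiltonian (linkGraph j) t 0) u v huv,
    sum_plaquetteNorm_eq_card_mul_sum_offset hkM hq hq0 (hamiltonian plaquetteGraph t U) u v huv,
    sum_linkNorm_eq_card_mul_sum_offset hkM hq hm hq0 (fun j => hamiltonian (linkGraph j) t 0) u v huv] at hD
  -- arithmetic: `|k| · |cell| = (2m)²`
  have hK : (0 : ℝ) < (Fintype.card (RectTorusSite k) : ℝ) := by exact_mod_cast Fintype.card_pos
  have hcell : (0 : ℝ) < ∏ i, (M i : ℝ) := Finset.prod_pos fun i _ => by exact_mod_cast Nat.pos_of_ne_zero (NeZero.ne (M i))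
  have hL2 : ((m * 2 : ℕ) : ℝ) ^ 2 = (Fintype.card (RectTorusSite k) : ℝ) * ∏ i, (M i : ℝ) := (card_cells_mul_prod_side hkM).symm
  -- separate the plaquette and the link offset sums in the goal, then name the four offset sums
  rw [Finset.sum_add_distrib]
  generalize (∑ r : (i : Fin 2) → Fin (q i), ∑ s : Finset (Orb (FermionTorus 2 2)), ∑ s' : Finset (Orb (FermionTorus 2 2)),
      ((v r)ᴴ * hamiltonian plaquetteGraph t U * v r) s s' *
        slaterRDM (Matrix.of fun o o' : Orb (FermionTorus 2 2) => if (ofLex o).2 = (ofLex o').2 then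
          ((Fintype.card (RectTorusSite k) : ℂ))⁻¹ * ∑ κ, Q (ofLex o).2 κ
            (fun i => (((ofLex (ofLex o).1 i : ℕ) + 2 * (r i : ℕ) : ℕ) : ZMod (M i)))
            (fun i => (((ofLex (ofLex o').1 i : ℕ) + 2 * (r i : ℕ) : ℕ) : ZMod (M i))) else 0) s s') = CA at hD ⊢
  generalize (∑ r : (i : Fin 2) → Fin (q i), ∑ j : Fin 2,
      ∑ s : Finset (Orb (Fin 2 ×ₗ FermionTorus 2 2)), ∑ s' : Finset (Orb (Fin 2 ×ₗ FermionTorus 2 2)),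
        ((fermionEmbed inlCell (v r) * fermionEmbed inrCell
              (v (fun i => ⟨(if i = j then (r i : ℕ) + 1 else (r i : ℕ)) % q i, Nat.mod_lt _ (hq0 i)⟩)))ᴴ *
            hamiltonian (linkGraph j) t 0 *
            (fermionEmbed inlCell (v r) * fermionEmbed inrCell
              (v (fun i => ⟨(if i = j then (r i : ℕ) + 1 else (r i : ℕ)) % q i, Nat.mod_lt _ (hq0 i)⟩)))) s s' *
          slaterRDM (Matrix.of fun o o' : Orb (Fin 2 ×ₗ FermionTorus 2 2) => if (ofLex o).2 = (ofLex o').2 then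
            ((Fintype.card (RectTorusSite k) : ℂ))⁻¹ * ∑ κ, blockChar κ
              ((if (ofLex (ofLex o).1).1 = 0 then (0 : RectTorusSite k) else if (r j : ℕ) + 1 < q j then 0 else Pi.single j 1) -
                (if (ofLex (ofLex o').1).1 = 0 then (0 : RectTorusSite k) else if (r j : ℕ) + 1 < q j then 0 else Pi.single j 1)) *
              Q (ofLex o).2 κ
                (fun i => (((ofLex (ofLex (ofLex o).1).2 i : ℕ) + 2 * (if (ofLex (ofLex o).1).1 = 0 then (r i : ℕ) else
                  if i = j then ((r j : ℕ) + 1) % q j else (r i : ℕ)) : ℕ) : ZMod (M i)))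
                (fun i => (((ofLex (ofLex (ofLex o').1).2 i : ℕ) + 2 * (if (ofLex (ofLex o').1).1 = 0 then (r i : ℕ) else
                  if i = j then ((r j : ℕ) + 1) % q j else (r i : ℕ)) : ℕ) : ZMod (M i))) else 0) s s') = CB at hD ⊢
  generalize (∑ r : (i : Fin 2) → Fin (q i), ∑ s : Finset (Orb (FermionTorus 2 2)), ∑ s' : Finset (Orb (FermionTorus 2 2)),
      ‖((v r)ᴴ * hamiltonian plaquetteGraph t U * v r) s s'‖) = nX at hD ⊢
  generalize (∑ r : (i : Fin 2) → Fin (q i), ∑ j : Fin 2,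
      ∑ s : Finset (Orb (Fin 2 ×ₗ FermionTorus 2 2)), ∑ s' : Finset (Orb (Fin 2 ×ₗ FermionTorus 2 2)),
        ‖((fermionEmbed inlCell (v r) * fermionEmbed inrCell
              (v (fun i => ⟨(if i = j then (r i : ℕ) + 1 else (r i : ℕ)) % q i, Nat.mod_lt _ (hq0 i)⟩)))ᴴ *
            hamiltonian (linkGraph j) t 0 *
            (fermionEmbed inlCell (v r) * fermionEmbed inrCell
              (v (fun i => ⟨(if i = j then (r i : ℕ) + 1 else (r i : ℕ)) % q i, Nat.mod_lt _ (hq0 i)⟩)))) s s'‖) = nY at hD ⊢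
  generalize (Fintype.card (Orb (FermionTorus 2 2))) = w₁ at hD ⊢
  generalize (Fintype.card (Orb (Fin 2 ×ₗ FermionTorus 2 2))) = w₂ at hD ⊢
  -- the arithmetic
  have hre : (((Fintype.card (RectTorusSite k) : ℂ)) * CA + ((Fintype.card (RectTorusSite k) : ℂ)) * CB).re =
      (Fintype.card (RectTorusSite k) : ℝ) * (CA + CB).re := by
    rw [← mul_add, Complex.mul_re]
    simp [Complex.natCast_re, Complex.natCast_im]
  have e1 : (((Fintype.card (RectTorusSite k) : ℂ)) * CA + ((Fintype.card (RectTorusSite k) : ℂ)) * CB).re / ((m * 2 : ℕ) : ℝ) ^ 2 =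
      (CA + CB).re / ∏ i, (M i : ℝ) := by
    rw [hre, hL2]
    field_simp
  have e2 : ((Fintype.card (RectTorusSite k) : ℝ) * nX * (2 ^ w₁ * ((w₁.factorial : ℝ) * (2 * (w₁ : ℝ) ^ 2 / (Fintype.card (RectTorusSite k) : ℝ)))) +
      (Fintype.card (RectTorusSite k) : ℝ) * nY * (2 ^ w₂ * ((w₂.factorial : ℝ) * (2 * (w₂ : ℝ) ^ 2 / (Fintype.card (RectTorusSite k) : ℝ))))) =
      nX * (2 ^ w₁ * ((w₁.factorial : ℝ) * (2 * (w₁ : ℝ) ^ 2))) + nY * (2 ^ w₂ * ((w₂.factorial : ℝ) * (2 * (w₂ : ℝ) ^ 2))) := by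
    field_simp
  rw [e1, e2] at hD
  exact hD

end Summit.Ventures.CertifiedManyBodySolver.Upper
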